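/-
Copyright (c) 2026 the pub-hodgecm-mathlib formalisation cell (harness21).  Prover seat hodgecm-mathlib-B-p04 (g47): LH4-plan (g6) WORD #13∕#14 — the M3∕M4 CONSUMER
COROLLARY of ★ (W3a) `LocalFields/UnramifiedQuadraticFixedClassSquare`; 2026-09-02.
-/
import Literature.NumberTheory.Rogawski1990.LocalIrreducibleTorusDiscriminantOdd       -- ★ odd twin + `sq_mul_trace_sq_sub_four_mul_det_eq_of_kappa_sq`; brings ★ B-p14 `exists_kappa_sq_eq_toLocalRing`, the CM carriers
import Literature.NumberTheory.LocalFields.UnramifiedQuadraticFixedClassSquare          -- ★ (W3a) `valued_four_lt_valued_mul_sq_sub_one_of_not_isSquare`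
import Literature.NumberTheory.LocalFields.WildQuadraticNormGroupAPI                    -- ★ conductor API: `conductor_of_valued_odd`, `conductor_one_add_of_odd_defect`, `conductor_iff_of_forall_mul_self_ne`; (C4) `exists_unit_mul_sq_depth_dichotomy`
import Literature.NumberTheory.Automorphic.LocalUnitaryGroupCongr                       -- ★ `local_eq_unitaryGroupOfForm_map`
import Literature.NumberTheory.Automorphic.QuadraticHeckeCharacterCM                    -- ★ `cmQuadraticGenerator_spec`
import HarnessLib

/-!
# The discriminant of the IRREDUCIBLE unitary `2 × 2` block is never in the unramified-or-square class of `L_w`: at an inert-unramified place `v` of the CM field,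
# `L_w(√disc χ_g)∕L_w` is RAMIFIED — conductor `f ≥ 2` at `v ∣ 2` (Rogawski 1990 §3.6 p. 31, §4.9 p. 55; Serre XV §2; O'Meara §63A)

Topic `NumberTheory/Rogawski1990`; namespace `Literature.NumberTheory.Rogawski1990`.  THEOREMS ONLY (no definition, no instance, no notation, no named fact, no `sorry`);
count-neutral; kernel lane `--supports stmt-HodgeConjecture-24833`.  Cell `pub/hodgecm-mathlib` (D-0151), crux H413 = `stmt-HodgeConjecture-24833`, half A line LH4 (dyadic
pay-down; census F0P3a-p06 (g17) `DUNR-H2-CENSUS` mechanisms M3∕M4), LH4-plan (g6) WORD #13∕#14: the CONSUMER COROLLARY of ★ (W3a) `UnramifiedQuadraticFixedClassSquare`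
(B-p04 (g47) p851544) in the currency of ★ `LocalIrreducibleTorusDiscriminantOdd` (its binders `γH`, `hirr` are those of ★ `exists_irredExponents` ∕ the M3 files).
HONEST LABEL: HC_CM is proved only modulo the 7 printed citations (2 remaining named inputs: hLiu418 = stmt-HodgeConjecture-24832, h413 = stmt-HodgeConjecture-24833) until
rung 0 closes; count-neutral (pays no organ, opens no road).

THE MATHEMATICS.  `γ_H = (g, u) ∈ H_v = U(2) × U(1)` at a non-split place `v` of `L⁺` UNRAMIFIED in the CM field `L`, `w ∣ v`, `g_w := g.map eval_w`, `D := tr² g_w − 4 det g_w`,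
`χ_{g,w}` WITHOUT a root in `L_w` (`hirr`).  ★ B-p14 `exists_kappa_sq_eq_toLocalRing`: `E_v[g] ∋ κ = α₀ + β₀ g` (`β₀ ≠ 0`) with `κ² = ι_v(k)`, `k ∈ L⁺_v` NOT a square in `E_v`,
so `β₀²·D = 4·ι_v(k)` (★ `sq_mul_trace_sq_sub_four_mul_det_eq_of_kappa_sq`) — read at `w`: **`(β₀)_w²·D = 4·ι_w(k)`** with `ι_w(k)` `σ_w`-FIXED and NOT A SQUARE in `L_w` (§1;
any residue characteristic).  Hence, by ★ (W3a) `valued_four_lt_valued_mul_sq_sub_one_of_not_isSquare` («a `σ_w`-fixed non-square is not in the class `(1 + 4𝒪_w)·(L_w^×)²`»),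
**`v_w(4) < v_w(D·y² − 1)` for every `y` with `v_w(D·y²) = 1`** (§2) — at odd `w` this is vacuous because `ord_w D` is odd (★ `exists_valued_disc_eq_exp_neg_odd_of_not_exists_isRoot`),
at `v ∣ 2` it says `D ∉ (1 + 4𝒪_w)·(L_w^×)²`: the quadratic extension `K₂ = L_w(√D) = L_w[g]` is NOT the unramified one.  §3 reads this on the norm group `N_D = N(K₂^×)` of the ★
wild layer: some PRINCIPAL unit `x ∈ U^{(1)}` is not a norm (★ (ii-odd) `conductor_of_valued_odd` if `ord_w D` is odd; else ★ (C4) `exists_unit_mul_sq_depth_dichotomy` puts the unit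
class of `D` in the `4𝒪`-defect class — excluded by §2 — or in an odd-defect class, where ★ (ii-defect) `conductor_one_add_of_odd_defect` supplies the witness), i.e. the conductor
`f(K₂∕L_w)` of ★ `conductor_iff_of_forall_mul_self_ne` satisfies **`2 ≤ f`** — «`K₂∕L⁺_v` is biquadratic, so `K₂∕L_w` is ramified» (LH4-plan (g6) WORD #3 (W3)), the input of the
self-dual-lattice counts (M4) and the Euler–Poincaré relation (M6) on WILD type-(2) tori.

## References
* [Rogawski1990] J. D. Rogawski, *Automorphic Representations of Unitary Groups in Three Variables*, Ann. of Math. Stud. 123 (1990), §3.6 p. 31 (type-(2) tori `E¹ × (EK)¹`,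
  `K ≠ E`), §4.9 p. 55.
* [Serre1979] J.-P. Serre, *Local Fields*, GTM 67 (1979), Ch. V §2 Prop. 3 (unramified ⇒ units are norms), Ch. XV §2 (conductor on `U^{(n)}`), Ch. XIV §4.
* [Omeara1963] O. T. O'Meara, *Introduction to Quadratic Forms*, Grundlehren 117 (1963), §63A 63:2–63:5, §63B 63:11a.
-/

set_option autoImplicit false

noncomputable section

open Matrix NumberField IsDedekindDomain Polynomial WithZero
open scoped MatrixGroups Valued

namespace Literature.NumberTheory.Rogawski1990

open Literature.AlgebraicGeometry.ShimuraVarieties Literature.NumberTheory.Automorphic Literature.NumberTheory.Automorphic.UnitaryGroup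
open Literature.NumberTheory.GaloisRepresentations Literature.NumberTheory.LocalFields Literature.NumberTheory.LocalFields.UnramifiedQuadraticNorm

section CM

variable (L : Type) [Field L] [NumberField L] [IsCMField L] (v : HeightOneSpectrum (𝓞 ↥(maximalRealSubfield L)))
  (w : PlacesOver L v) (hw : IsCMField.complexConj L • w.1 = w.1)

omit [IsCMField L] in
/-- `¬ IsUnit (2 : 𝒪_w)` (the dyadic leaf's token) read as `v_w(2) < 1` — the binder `h2v` of §3 (converse reading of ★ `valued_two_eq_one_of_isUnit`). [cite: Omeara1963, §11] -/
theorem valued_two_lt_one_of_not_isUnit (h2 : ¬ IsUnit (2 : 𝒪[w.1.adicCompletion L])) : Valued.v (2 : w.1.adicCompletion L) < 1 := by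
  refine lt_of_le_of_ne (2 : 𝒪[w.1.adicCompletion L]).2 fun h => h2 ?_
  refine (Valuation.integer.integers (Valued.v (R := w.1.adicCompletion L))).isUnit_iff_valuation_eq_one.2 ?_
  rw [map_ofNat]
  exact h

/-! ## §1 `β₀²·disc χ_{g,w} = 4·ι_w(k)` with `ι_w(k)` a `σ_w`-fixed non-square (any residue characteristic) -/

include hw in
/-- **`(β₀)_w² · (tr² g_w − 4 det g_w) = 4 · ι_w(k)` with `ι_w(k)` `σ_w`-FIXED and NOT A SQUARE in `L_w`, `(β₀)_w ≠ 0`**, for the `U(2)`-part `g` of `γ_H = (g, u) ∈ H_v` at a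
non-split place `v` with `χ_{g,w}` rootless in `L_w` — the packaging of the first half of ★ `exists_valued_disc_eq_exp_neg_odd_of_not_exists_isRoot` (★ B-p14
`exists_kappa_sq_eq_toLocalRing`, ★ `sq_mul_trace_sq_sub_four_mul_det_eq_of_kappa_sq`, ★ `not_isSquare_of_kappa`), valid at every residue characteristic: «`disc χ_g` is an
`L⁺_v`-class times a square, and that class is a non-square of `L_w`» (the biquadratic structure of `L_w[g]`). [cite: Rogawski1990, §3.6 p. 31] -/
theorem exists_sq_mul_disc_eq_four_mul_toPlace_of_not_exists_isRoot
    {γH : (cmDatum L 2 (Matrix.of fun i j : Fin 2 => if i.val + j.val + 1 = 2 then (1 : L) else 0)).Local v ×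
      (cmDatum L 1 (Matrix.of fun i j : Fin 1 => if i.val + j.val + 1 = 1 then (1 : L) else 0)).Local v}
    (hirr : ¬ ∃ x : w.1.adicCompletion L, (((γH.1.val : GL (Fin 2) (LocalRing L v)).val.map
        (Pi.evalRingHom (fun w' : PlacesOver L v => w'.1.adicCompletion L) w)).charpoly).IsRoot x) :
    ∃ (k : v.adicCompletion ↥(maximalRealSubfield L)) (β : w.1.adicCompletion L), β ≠ 0 ∧
      galAdicCompletionMap (L := L) (IsCMField.complexConj L) hw (UnitaryGroup.toPlace v w k) = UnitaryGroup.toPlace v w k ∧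
      ¬ IsSquare (UnitaryGroup.toPlace v w k) ∧
      β ^ 2 * (((γH.1.val : GL (Fin 2) (LocalRing L v)).val.map (Pi.evalRingHom (fun w' : PlacesOver L v => w'.1.adicCompletion L) w)).trace ^ 2 -
        4 * ((γH.1.val : GL (Fin 2) (LocalRing L v)).val.map (Pi.evalRingHom (fun w' : PlacesOver L v => w'.1.adicCompletion L) w)).det) =
        4 * UnitaryGroup.toPlace v w k := by
  have hc1 : IsCMField.complexConj L ≠ 1 := IsCMField.complexConj_ne_one L
  haveI : Subsingleton (PlacesOver L v) := PlacesOver.subsingleton_of_smul_eq (IsCMField.complexConj L) hc1 w hw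
  letI : Field (LocalRing L v) := (LocalRing.isField_of_smul_eq (IsCMField.complexConj L) hc1 w hw).toField
  set ev := Pi.evalRingHom (fun w' : PlacesOver L v => w'.1.adicCompletion L) w with hev
  set A : Matrix (Fin 2) (Fin 2) (LocalRing L v) := (γH.1.val : GL (Fin 2) (LocalRing L v)).val with hAdef
  -- `χ_A` has no root in `E_v`
  have hA : ∀ r : LocalRing L v, A.charpoly.eval r ≠ 0 := by
    intro r hr
    refine hirr ⟨r w, ?_⟩
    rw [Matrix.charpoly_map, Polynomial.IsRoot.def, Polynomial.eval_map]
    have h := Polynomial.eval₂_at_apply (p := A.charpoly) ev r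
    rw [hr, map_zero] at h
    exact h
  -- `Φ₂` over `E_v`: hermitian, unit determinant; `g` unitary for it
  have hΦ : (Matrix.of fun i j : Fin 2 => if i.val + j.val + 1 = 2 then (1 : L) else 0).map (algebraMap L (LocalRing L v)) =
      Matrix.of fun i j : Fin 2 => if i.val + j.val + 1 = 2 then (1 : LocalRing L v) else 0 := by
    ext i j
    simp only [map_apply, of_apply]
    split_ifs <;> simp
  have hΦh : ((Matrix.of fun i j : Fin 2 => if i.val + j.val + 1 = 2 then (1 : LocalRing L v) else 0).map (conjLocal L (IsCMField.complexConj L) v))ᵀ =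
      Matrix.of fun i j : Fin 2 => if i.val + j.val + 1 = 2 then (1 : LocalRing L v) else 0 := by
    ext i j
    fin_cases i <;> fin_cases j <;> simp [Matrix.of_apply]
  have hΦd : IsUnit (Matrix.of fun i j : Fin 2 => if i.val + j.val + 1 = 2 then (1 : LocalRing L v) else 0).det := by
    rw [Matrix.det_fin_two]
    simp [Matrix.of_apply]
  have hAu : (A.map (conjLocal L (IsCMField.complexConj L) v))ᵀ * (Matrix.of fun i j : Fin 2 => if i.val + j.val + 1 = 2 then (1 : LocalRing L v) else 0) * A =
      Matrix.of fun i j : Fin 2 => if i.val + j.val + 1 = 2 then (1 : LocalRing L v) else 0 := by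
    have h : (γH.1.val : GL (Fin 2) (LocalRing L v)) ∈ unitaryGroupOfForm (conjLocal L (IsCMField.complexConj L) v)
        ((Matrix.of fun i j : Fin 2 => if i.val + j.val + 1 = 2 then (1 : L) else 0).map (algebraMap L (LocalRing L v))) := by
      rw [← local_eq_unitaryGroupOfForm_map]
      exact γH.1.property
    rw [hΦ] at h
    exact h
  -- B-p14's `κ = α₀ + β₀ g`, `κ² = ι_v(k)`, `ι_v(k)` not a square in `E_v`
  obtain ⟨δ, hδ0, hcδ, -⟩ := cmQuadraticGenerator_spec L
  obtain ⟨α₀, β₀, k, hβ₀, -, hsq, -⟩ :=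
    exists_kappa_sq_eq_toLocalRing L v (IsCMField.complexConj L) hcδ hδ0 w hw hΦh hΦd hAu hA
  have hkE : ¬ IsSquare (toLocalRing L v k) := not_isSquare_of_kappa hA rfl hβ₀ hsq
  have hdisc : β₀ ^ 2 * (A.trace ^ 2 - 4 * A.det) = 4 * toLocalRing L v k :=
    sq_mul_trace_sq_sub_four_mul_det_eq_of_kappa_sq hsq hβ₀ (ne_smul_one_of_eval_charpoly_ne_zero hA)
  have hdiscw : (β₀ w) ^ 2 * ((A.map ev).trace ^ 2 - 4 * (A.map ev).det) = 4 * UnitaryGroup.toPlace v w k := by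
    have h := congrArg ev hdisc
    rw [map_mul, map_pow, map_sub, map_mul, map_pow, map_mul, AddMonoidHom.map_trace ev A, RingHom.map_det ev A] at h
    simpa [hev] using h
  have hzns : ¬ IsSquare (UnitaryGroup.toPlace v w k) := by
    rintro ⟨s, hs⟩
    letI : Unique (PlacesOver L v) := uniqueOfSubsingleton w
    let π : LocalRing L v ≃+* w.1.adicCompletion L := RingEquiv.piUnique fun w' : PlacesOver L v => w'.1.adicCompletion L
    apply hkE
    refine ⟨π.symm s, (LocalRing.eq_iff_apply_eq (IsCMField.complexConj L) hc1 w hw _ _).2 ?_⟩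
    rw [toLocalRing_apply, Pi.mul_apply]
    change UnitaryGroup.toPlace v w k = π (π.symm s) * π (π.symm s)
    rw [π.apply_symm_apply]
    exact hs
  have hβw : β₀ w ≠ 0 := fun h0 => hβ₀ ((LocalRing.eq_iff_apply_eq (IsCMField.complexConj L) hc1 w hw β₀ 0).2 (by rw [h0]; rfl))
  exact ⟨k, β₀ w, hβw, UnitaryGroup.galAdicCompletionMap_toPlace_self L v w hw k, hzns, hdiscw⟩

/-! ## §2 `disc χ_{g,w}` is not in the unramified-or-square class `(1 + 4𝒪_w)·(L_w^×)²` -/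

include hw in
/-- **`v_w(4) < v_w(disc χ_{g,w} · y² − 1)` FOR EVERY `y` WITH `v_w(disc χ_{g,w} · y²) = 1`** — the discriminant of the rootless unitary `2 × 2` block at an inert-UNRAMIFIED
place is NOT in the unramified-or-square class of `L_w` (any residue characteristic; vacuous at odd `w`, where `ord_w disc` is odd by ★
`exists_valued_disc_eq_exp_neg_odd_of_not_exists_isRoot`).  From §1 (`D·y² = ι_w(k)·(2y∕β₀)²`) and ★ (W3a) `valued_four_lt_valued_mul_sq_sub_one_of_not_isSquare`.
Reading: `K₂ = L_w(√disc) = L_w[g]` is NOT the unramified quadratic extension of `L_w` — «`K₂∕L⁺_v` biquadratic ⇒ `K₂∕L_w` ramified».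
[cite: Rogawski1990, §3.6 p. 31] [cite: Serre1979, Ch. V §2 Prop. 3; Ch. XIV §4] [cite: Omeara1963, §63A 63:3] -/
theorem valued_four_lt_valued_disc_mul_sq_sub_one_of_not_exists_isRoot (hunr : Algebra.IsUnramifiedIn (𝓞 L) v.asIdeal)
    {γH : (cmDatum L 2 (Matrix.of fun i j : Fin 2 => if i.val + j.val + 1 = 2 then (1 : L) else 0)).Local v ×
      (cmDatum L 1 (Matrix.of fun i j : Fin 1 => if i.val + j.val + 1 = 1 then (1 : L) else 0)).Local v}
    (hirr : ¬ ∃ x : w.1.adicCompletion L, (((γH.1.val : GL (Fin 2) (LocalRing L v)).val.map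
        (Pi.evalRingHom (fun w' : PlacesOver L v => w'.1.adicCompletion L) w)).charpoly).IsRoot x)
    {y : w.1.adicCompletion L}
    (h1 : Valued.v ((((γH.1.val : GL (Fin 2) (LocalRing L v)).val.map (Pi.evalRingHom (fun w' : PlacesOver L v => w'.1.adicCompletion L) w)).trace ^ 2 -
        4 * ((γH.1.val : GL (Fin 2) (LocalRing L v)).val.map (Pi.evalRingHom (fun w' : PlacesOver L v => w'.1.adicCompletion L) w)).det) * (y * y)) = 1) :
    Valued.v (4 : w.1.adicCompletion L) <
      Valued.v ((((γH.1.val : GL (Fin 2) (LocalRing L v)).val.map (Pi.evalRingHom (fun w' : PlacesOver L v => w'.1.adicCompletion L) w)).trace ^ 2 -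
        4 * ((γH.1.val : GL (Fin 2) (LocalRing L v)).val.map (Pi.evalRingHom (fun w' : PlacesOver L v => w'.1.adicCompletion L) w)).det) * (y * y) - 1) := by
  obtain ⟨k, β, hβ0, hσz, hzns, hD⟩ := exists_sq_mul_disc_eq_four_mul_toPlace_of_not_exists_isRoot L v w hw hirr
  set D := ((γH.1.val : GL (Fin 2) (LocalRing L v)).val.map (Pi.evalRingHom (fun w' : PlacesOver L v => w'.1.adicCompletion L) w)).trace ^ 2 -
        4 * ((γH.1.val : GL (Fin 2) (LocalRing L v)).val.map (Pi.evalRingHom (fun w' : PlacesOver L v => w'.1.adicCompletion L) w)).det with hDdef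
  set z := UnitaryGroup.toPlace v w k with hz
  -- `D·y² = z·(2y∕β)²`
  have hre : D * (y * y) = z * ((2 * y / β) * (2 * y / β)) := by
    have hD' : D = 4 * z / β ^ 2 := by rw [eq_div_iff (pow_ne_zero 2 hβ0), mul_comm, hD]
    rw [hD']; field_simp; ring
  rw [hre] at h1 ⊢
  exact valued_four_lt_valued_mul_sq_sub_one_of_not_isSquare L v w hw hunr hσz hzns h1

/-! ## §3 At `v ∣ 2`: a principal unit of `L_w` that is not a norm from `L_w(√disc χ_{g,w})` — conductor `f ≥ 2` -/

include hw in
/-- **AT AN INERT-UNRAMIFIED DYADIC PLACE SOME PRINCIPAL UNIT OF `L_w` IS NOT A NORM FROM `K₂ = L_w(√disc χ_{g,w})`** (`χ_{g,w}` rootless): `x ∈ U^{(1)}` (`v x = 1`, `v(x − 1) < 1`)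
with `x ∉ N_D = {a² − D b²}` — i.e. `U^{(1)} ⊄ N(K₂^×)`, the conductor of `K₂∕L_w` is `≥ 2`.  If `ord_w D` is odd, ★ (ii-odd) `conductor_of_valued_odd` gives a unit of depth `v 4` outside
`N_D`; if `D = u·y₁²` with `u` a unit, ★ (C4) `exists_unit_mul_sq_depth_dichotomy` puts `u·t²` either in `1 + 4𝒪_w` — excluded by §2 — or at an odd depth `w₀ = u t² − 1`, `v 4 < v w₀ < 1`,
where ★ (ii-defect) `conductor_one_add_of_odd_defect` gives a unit `x` of depth `v 4 ∕ v w₀ < 1` outside `N_{1 + w₀} = N_D` (★ `exists_sq_sub_mul_sq_iff_mul_sq`).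
[cite: Serre1979, Ch. XV §2] [cite: Omeara1963, §63A 63:2–63:5; §63B 63:11a] [cite: Rogawski1990, §4.9 p. 55] -/
theorem exists_principal_unit_not_norm_disc_of_not_exists_isRoot (hunr : Algebra.IsUnramifiedIn (𝓞 L) v.asIdeal)
    (h2v : Valued.v (2 : w.1.adicCompletion L) < 1)
    {γH : (cmDatum L 2 (Matrix.of fun i j : Fin 2 => if i.val + j.val + 1 = 2 then (1 : L) else 0)).Local v ×
      (cmDatum L 1 (Matrix.of fun i j : Fin 1 => if i.val + j.val + 1 = 1 then (1 : L) else 0)).Local v}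
    (hirr : ¬ ∃ x : w.1.adicCompletion L, (((γH.1.val : GL (Fin 2) (LocalRing L v)).val.map
        (Pi.evalRingHom (fun w' : PlacesOver L v => w'.1.adicCompletion L) w)).charpoly).IsRoot x) :
    ∃ x : w.1.adicCompletion L, Valued.v x = 1 ∧ Valued.v (x - 1) < 1 ∧
      ¬ ∃ a b : w.1.adicCompletion L, a * a -
        (((γH.1.val : GL (Fin 2) (LocalRing L v)).val.map (Pi.evalRingHom (fun w' : PlacesOver L v => w'.1.adicCompletion L) w)).trace ^ 2 -
          4 * ((γH.1.val : GL (Fin 2) (LocalRing L v)).val.map (Pi.evalRingHom (fun w' : PlacesOver L v => w'.1.adicCompletion L) w)).det) * (b * b) = x := by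
  haveI := Literature.NumberTheory.Automorphic.isAdicComplete_valuedMaximalIdeal_valuedInteger_adicCompletion L w.1
  haveI : Finite 𝓀[w.1.adicCompletion L] := Literature.NumberTheory.Automorphic.finite_residueField_adicCompletion L w.1
  set D := ((γH.1.val : GL (Fin 2) (LocalRing L v)).val.map (Pi.evalRingHom (fun w' : PlacesOver L v => w'.1.adicCompletion L) w)).trace ^ 2 -
        4 * ((γH.1.val : GL (Fin 2) (LocalRing L v)).val.map (Pi.evalRingHom (fun w' : PlacesOver L v => w'.1.adicCompletion L) w)).det with hDdef
  have h2 : (2 : w.1.adicCompletion L) ≠ 0 := by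
    rw [show (2 : w.1.adicCompletion L) = algebraMap L (w.1.adicCompletion L) 2 by rw [map_ofNat]]
    exact (_root_.map_ne_zero (algebraMap L (w.1.adicCompletion L))).2 two_ne_zero
  have hv2 : Valued.v (2 : w.1.adicCompletion L) ≠ 0 := (Valuation.ne_zero_iff _).2 h2
  have hv4 : Valued.v (4 : w.1.adicCompletion L) < 1 := by
    rw [show (4 : w.1.adicCompletion L) = 2 * 2 by norm_num, map_mul]; exact (mul_le_of_le_one_left' h2v.le).trans_lt h2v
  have hv40 : Valued.v (4 : w.1.adicCompletion L) ≠ 0 := by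
    rw [show (4 : w.1.adicCompletion L) = 2 * 2 by norm_num, map_mul]; exact mul_ne_zero hv2 hv2
  -- §2 at hand
  have key : ∀ y : w.1.adicCompletion L, Valued.v (D * (y * y)) = 1 → Valued.v (4 : w.1.adicCompletion L) < Valued.v (D * (y * y) - 1) :=
    fun y hy => valued_four_lt_valued_disc_mul_sq_sub_one_of_not_exists_isRoot L v w hw hunr hirr hy
  by_cases hodd : ∀ y : w.1.adicCompletion L, Valued.v D ≠ Valued.v y * Valued.v y
  · -- odd order: a unit of depth `v 4` is not a norm
    obtain ⟨-, x, hx1, hx4, hxN⟩ := conductor_of_valued_odd h2 h2v hodd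
    exact ⟨x, hx1, by rw [hx4]; exact hv4, hxN⟩
  · -- even order: `D = u · y₁²` with `u` a unit
    push Not at hodd
    obtain ⟨y₁, hy₁⟩ := hodd
    obtain ⟨k, β, hβ0, -, hzns, hD⟩ := exists_sq_mul_disc_eq_four_mul_toPlace_of_not_exists_isRoot L v w hw hirr
    have hD0 : D ≠ 0 := by
      intro h0
      have hz0 : UnitaryGroup.toPlace v w k = 0 := by
        have h := hD; rw [← hDdef, h0, mul_zero] at h
        exact (mul_eq_zero.1 h.symm).resolve_left (by rw [show (4 : w.1.adicCompletion L) = 2 * 2 by norm_num]; exact mul_ne_zero h2 h2)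
      exact hzns ⟨0, by rw [hz0, mul_zero]⟩
    have hy₁0 : y₁ ≠ 0 := by
      intro h0; rw [h0, map_zero, mul_zero] at hy₁; exact (Valuation.ne_zero_iff _).2 hD0 hy₁
    have hvy₁ : Valued.v y₁ ≠ 0 := (Valuation.ne_zero_iff _).2 hy₁0
    set u : w.1.adicCompletion L := D / (y₁ * y₁) with hudef
    have hu : Valued.v u = 1 := by
      rw [hudef, map_div₀, map_mul, hy₁]; exact div_self (mul_ne_zero hvy₁ hvy₁)
    have hDu : D = u * (y₁ * y₁) := by rw [hudef, div_mul_cancel₀ _ (mul_ne_zero hy₁0 hy₁0)]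
    -- (C4) on the unit `u`
    obtain ⟨t, ht1, hcase⟩ := exists_unit_mul_sq_depth_dichotomy h2 h2v
      (exists_valued_mul_self_sub_lt_one_of_finite_residueField (K := w.1.adicCompletion L) h2v)
      (UnitaryGroup.valued_toPlace_uniformizer L v w hunr) hu
    have ht0 : t ≠ 0 := (Valuation.ne_zero_iff _).1 (by rw [ht1]; exact one_ne_zero)
    -- `u·t² = D·(t∕y₁)²`
    have hut : u * (t * t) = D * ((t / y₁) * (t / y₁)) := by rw [hDu]; field_simp
    rcases hcase with hα | ⟨h4w, hw1, hwodd⟩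
    · -- the `4𝒪`-defect class is excluded by §2
      exfalso
      have h1 : Valued.v (D * ((t / y₁) * (t / y₁))) = 1 := by rw [← hut, map_mul, map_mul, hu, ht1, one_mul, one_mul]
      have h := key (t / y₁) h1
      rw [← hut] at h
      exact (lt_irrefl _) (h.trans_le hα)
    · -- odd defect: (ii-defect) witness, transported to `N_D`
      set w₀ : w.1.adicCompletion L := u * (t * t) - 1 with hw₀def
      obtain ⟨-, x, hx1, hxd, hxN⟩ := conductor_one_add_of_odd_defect h2 h2v hw1 h4w hwodd
      have hvw₀ : Valued.v w₀ ≠ 0 := ne_of_gt (lt_of_le_of_lt zero_le h4w)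
      refine ⟨x, hx1, ?_, ?_⟩
      · -- depth `v(x − 1) = v 4 ∕ v w₀ < 1`
        have h : Valued.v (x - 1) = Valued.v (4 : w.1.adicCompletion L) * (Valued.v w₀)⁻¹ := by
          rw [eq_mul_inv_iff_mul_eq₀ hvw₀, mul_comm, ← map_mul, hxd]
        rw [h, mul_inv_lt_iff₀ (zero_lt_iff.2 hvw₀), one_mul]
        exact h4w
      · -- `N_{1 + w₀} = N_{u t²} = N_D`
        rintro ⟨a, b, hab⟩
        apply hxN
        have h1w : 1 + w₀ = D * ((t / y₁) * (t / y₁)) := by rw [hw₀def, add_sub_cancel, hut]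
        rw [h1w]
        exact (exists_sq_sub_mul_sq_iff_mul_sq D (div_ne_zero ht0 hy₁0) x).1 ⟨a, b, hab⟩

include hw in
/-- **THE CONDUCTOR OF `L_w(√disc χ_{g,w})∕L_w` IS `≥ 2` AT AN INERT-UNRAMIFIED DYADIC PLACE** (`χ_{g,w}` rootless; `ϖ` any uniformiser of `L_w`): with the define-free Artin
conductor `f` of ★ (ii′) `conductor_iff_of_forall_mul_self_ne` (`U^{(k)} ⊆ N_D ⟺ f ≤ k`), one has `2 ≤ f` — by §3's principal unit outside `N_D`.  This is the «wild conductor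
`a(K₂∕L_w) ≥ 2`» of the DUNR-H2-CENSUS mechanisms M4∕M6 for every WILD type-(2) torus at an inert-unramified `v ∣ 2` (value `2e + 1 − s` or `2e + 1` by ★ (ii)'s table).
[cite: Serre1979, Ch. XV §2] [cite: Omeara1963, §63A 63:2; §63B 63:11a] [cite: Rogawski1990, §4.9 p. 55] -/
theorem two_le_conductor_disc_of_not_exists_isRoot (hunr : Algebra.IsUnramifiedIn (𝓞 L) v.asIdeal)
    (h2v : Valued.v (2 : w.1.adicCompletion L) < 1) {ϖ : w.1.adicCompletion L} (hϖ : Valued.v ϖ = exp (-1 : ℤ))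
    {γH : (cmDatum L 2 (Matrix.of fun i j : Fin 2 => if i.val + j.val + 1 = 2 then (1 : L) else 0)).Local v ×
      (cmDatum L 1 (Matrix.of fun i j : Fin 1 => if i.val + j.val + 1 = 1 then (1 : L) else 0)).Local v}
    (hirr : ¬ ∃ x : w.1.adicCompletion L, (((γH.1.val : GL (Fin 2) (LocalRing L v)).val.map
        (Pi.evalRingHom (fun w' : PlacesOver L v => w'.1.adicCompletion L) w)).charpoly).IsRoot x) :
    ∃ f : ℕ, 2 ≤ f ∧ Valued.v ((4 : w.1.adicCompletion L) * ϖ) ≤ exp (-(f : ℤ)) ∧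
      ∀ k : ℕ, (∀ x : w.1.adicCompletion L, Valued.v x = 1 → Valued.v (x - 1) ≤ exp (-(k : ℤ)) →
        ∃ a b : w.1.adicCompletion L, a * a -
          (((γH.1.val : GL (Fin 2) (LocalRing L v)).val.map (Pi.evalRingHom (fun w' : PlacesOver L v => w'.1.adicCompletion L) w)).trace ^ 2 -
            4 * ((γH.1.val : GL (Fin 2) (LocalRing L v)).val.map (Pi.evalRingHom (fun w' : PlacesOver L v => w'.1.adicCompletion L) w)).det) * (b * b) = x) ↔
        f ≤ k := by
  haveI := Literature.NumberTheory.Automorphic.isAdicComplete_valuedMaximalIdeal_valuedInteger_adicCompletion L w.1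
  haveI : Finite 𝓀[w.1.adicCompletion L] := Literature.NumberTheory.Automorphic.finite_residueField_adicCompletion L w.1
  set A := ((γH.1.val : GL (Fin 2) (LocalRing L v)).val.map (Pi.evalRingHom (fun w' : PlacesOver L v => w'.1.adicCompletion L) w)) with hAdef
  have h2 : (2 : w.1.adicCompletion L) ≠ 0 := by
    rw [show (2 : w.1.adicCompletion L) = algebraMap L (w.1.adicCompletion L) 2 by rw [map_ofNat]]
    exact (_root_.map_ne_zero (algebraMap L (w.1.adicCompletion L))).2 two_ne_zero
  -- `D ≠ 0` and `D` is not a square (a square root `r` would give the root `(tr + r)∕2` of `χ`)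
  obtain ⟨k, β, hβ0, -, hzns, hD⟩ := exists_sq_mul_disc_eq_four_mul_toPlace_of_not_exists_isRoot L v w hw hirr
  have hD0 : A.trace ^ 2 - 4 * A.det ≠ 0 := by
    intro h0
    rw [h0, mul_zero] at hD
    have hz0 : UnitaryGroup.toPlace v w k = 0 :=
      (mul_eq_zero.1 hD.symm).resolve_left (by rw [show (4 : w.1.adicCompletion L) = 2 * 2 by norm_num]; exact mul_ne_zero h2 h2)
    exact hzns ⟨0, by rw [hz0, mul_zero]⟩
  have hns : ∀ r : w.1.adicCompletion L, r * r ≠ A.trace ^ 2 - 4 * A.det := by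
    intro r hr
    refine hirr ⟨(A.trace + r) / 2, ?_⟩
    rw [Matrix.charpoly_fin_two, Polynomial.IsRoot.def]
    simp only [eval_add, eval_sub, eval_mul, eval_pow, eval_C, eval_X]
    field_simp
    linear_combination hr
  obtain ⟨f, hfb, hiff⟩ := conductor_iff_of_forall_mul_self_ne h2 h2v hϖ hD0 hns
  refine ⟨f, ?_, hfb, hiff⟩
  obtain ⟨x, hx1, hxlt, hxN⟩ := exists_principal_unit_not_norm_disc_of_not_exists_isRoot L v w hw hunr h2v hirr
  by_contra hf
  rw [not_le] at hf
  exact hxN ((hiff 1).2 (by omega) x hx1 (by rw [Nat.cast_one]; exact (lt_one_iff_le_exp_neg_one _).1 hxlt))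

end CM

end Literature.NumberTheory.Rogawski1990

end
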